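import Summits.FinalStateConjecture.FinalStateConjecture.Theorems.EIHFluxBalanceInertialRecessionChargeKinematicsRuleAtoms

/-!
# Route EIHFluxBalance — `InertialRecession`, line `old-light-leaves-the-cone`: charge kinematics,
# XXV (general N, mechanism (E): the increment over a status piece)

Helper file for the crux `stmt-FinalStateConjecture-10166`
(`Summit.FinalStateConjecture.FinalStateConjecture.Theses.EIHFluxBalance.InertialRecession`), second line
lead, endgame stub `stub_expandingChargeKinematics` (S4: abstract quasi-conserved window charges with the
slack-form window law and the single-hole identification ⇒ Cesàro velocities of the painted centres).
THE ESCAPE SERIES: the endgame for `N = 3` (Case A all-pairs freezing is `ChargeKinematicsAllPairs*`;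
Case B, the escape of a fast hole from a velocity-tight pair, is this series; the assembly is
`ChargeKinematicsThree`).

XXV — GENERAL N, MECHANISM (E): THE INCREMENT OF THE ANCHOR OVER ONE STATUS PIECE
(`increment_on_status_piece`): a strictly free rule at the midpoint is weakly free on the piece, its member
set is constant, the window-law package applies, budget by `rule_window_budget_le`.

Every statement is Mathlib-only real analysis over the stub's verbatim hypotheses ([folklore]); the abstract
charge `P` is arbitrary (adversarial), constrained only by the window law and the identification.
-/

set_option linter.dupNamespace false

noncomputable section

open Filter Set Metric Real
open scoped Topology

namespace Summit.FinalStateConjecture.FinalStateConjecture.Theorems.ChargeKinematics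

open Literature.Geometry.Lorentzian

/-! ## The increment over a status piece -/

section StatusPiece

open MeasureTheory intervalIntegral

/-- **Increment over a status piece.** Abstract form of mechanism (E) on a piece `[p₀, q₀]` where every
blocking function `κ·max(m₀,|φ_y|) − C·d_p` (`κ ∈ {1,2}`, `C ∈ {2C_j, C_j}`, `C_j = 4·16^j`) has a constant
weak sign: a strictly free rule `j` at the midpoint (pigeonhole) is weakly free on the whole piece, its
member set is constant, the window law package of `(j, members)` applies, its budget is bounded by the
rule budget (`rule_window_budget_le` with `K = C_n`), and the anchor's increment follows from
`cluster_increment_of_budget`. [folklore] -/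
theorem increment_on_status_piece {ι κι : Type*} [DecidableEq ι] (T : Finset ι) (a : ι)
    (Y : Finset κι) (hY : Y.Nonempty) {n : ℕ} (hn : T.card ≤ n)
    {d : ι → ℝ → ℝ} {φ φ' : κι → ℝ → ℝ} {g : κι → ℝ} {Mc : ι → ℝ} {v : ι → ℝ → E3}
    {Qw : Fin (n + 1) → Finset ι → ℝ → Fin 4 → ℝ} {ew : ℝ → ℝ}
    {Cw k p₀ q₀ m₀ c₂ ε β' : ℝ}
    (hk1 : k < 1) (hp₀ : 0 < p₀) (hpq : p₀ < q₀) (hm₀ : 0 < m₀) (hm₀C : 4 * 16 ^ n ≤ m₀) (hc₂ : 0 < c₂)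
    (hct : 1 ≤ c₂ * p₀) (hCw : 0 ≤ Cw) (hM : ∀ c ∈ insert a T, 0 < Mc c) (haT : a ∉ T)
    (hvk : ∀ c ∈ insert a T, ‖v c p₀‖ ≤ k ∧ ‖v c q₀‖ ≤ k)
    (hr : ∀ p ∈ T, ‖v p p₀ - v a p₀‖ ≤ β' ∧ ‖v p q₀ - v a q₀‖ ≤ β') (hβ' : 0 ≤ β')
    (hcap : ∀ s ∈ Set.Icc p₀ q₀, (Y.inf' hY fun y ↦ max m₀ |φ y s|) ≤ c₂ * s)
    (hg : ∀ y ∈ Y, 0 < g y) (hφ : ∀ y ∈ Y, ∀ s, HasDerivAt (φ y) (φ' y s) s)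
    (hφ' : ∀ y ∈ Y, Continuous (φ' y)) (hmono : ∀ y ∈ Y, ∀ s ∈ Set.Icc p₀ q₀, g y ≤ φ' y s)
    (hsign₁ : ∀ p ∈ T, ∀ j : Fin (n + 1), ∀ y ∈ Y,
      (∀ s ∈ Set.Icc p₀ q₀, 0 ≤ max m₀ |φ y s| - 2 * (4 * 16 ^ (j : ℕ)) * d p s) ∨
      (∀ s ∈ Set.Icc p₀ q₀, max m₀ |φ y s| - 2 * (4 * 16 ^ (j : ℕ)) * d p s ≤ 0))
    (hsign₂ : ∀ p ∈ T, ∀ j : Fin (n + 1), ∀ y ∈ Y,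
      (∀ s ∈ Set.Icc p₀ q₀, 0 ≤ 2 * max m₀ |φ y s| - (4 * 16 ^ (j : ℕ)) * d p s) ∨
      (∀ s ∈ Set.Icc p₀ q₀, 2 * max m₀ |φ y s| - (4 * 16 ^ (j : ℕ)) * d p s ≤ 0))
    (hpkg : ∀ (j : Fin (n + 1)) (Ms : Finset ι), Ms ⊆ T → ∀ s₁ s₂, p₀ ≤ s₁ → s₁ ≤ s₂ → s₂ ≤ q₀ →
      (∀ s ∈ Set.Icc s₁ s₂, (∀ p ∈ Ms, 4 * d p s ≤ 2 * ((Y.inf' hY fun y ↦ max m₀ |φ y s|) / (4 * 16 ^ (j : ℕ)))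
          ∧ 2 * d p s ≤ c₂ * s) ∧
        (∀ p ∈ T, p ∉ Ms → 2 * ((Y.inf' hY fun y ↦ max m₀ |φ y s|) / (4 * 16 ^ (j : ℕ))) ≤ d p s)) →
      (∀ μ : Fin 4, |Qw j Ms s₂ μ - Qw j Ms s₁ μ| ≤
        Cw * (∫ s in s₁..s₂, ((min ((Y.inf' hY fun y ↦ max m₀ |φ y s|) / (4 * 16 ^ (j : ℕ))) (c₂ * s)) ^ 2)⁻¹ +
          ((min ((Y.inf' hY fun y ↦ max m₀ |φ y s|) / (4 * 16 ^ (j : ℕ))) (c₂ * s)) ^ (7 / 4 : ℝ))⁻¹) + ew s₁) ∧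
      (∀ s, (s = s₁ ∨ s = s₂) → |Qw j Ms s 0 - ∑ c ∈ insert a Ms, Mc c * (√(1 - ‖v c s‖ ^ 2))⁻¹| ≤ ew s ∧
        ∀ k' : Fin 3, |Qw j Ms s k'.succ - ∑ c ∈ insert a Ms, Mc c * (√(1 - ‖v c s‖ ^ 2))⁻¹ * v c s k'| ≤ ew s))
    (hew : ew p₀ ≤ ε ∧ ew q₀ ≤ ε) :
    ‖v a q₀ - v a p₀‖ ≤ 4 * (Cw * (∑ y ∈ Y, (9 * (2 * 2 * (3 * m₀ / (4 * 16 ^ n)) ^ (1 - 2 : ℝ) /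
        ((2 - 1) * (3 * g y / (4 * 16 ^ n)))) +
        (3 : ℝ) ^ (7 / 4 : ℝ) * (2 * (7 / 4) * (3 * m₀ / (4 * 16 ^ n)) ^ (1 - 7 / 4 : ℝ) /
          ((7 / 4 - 1) * (3 * g y / (4 * 16 ^ n)))) +
        ((c₂ ^ 2 * p₀)⁻¹ + 4 / 3 * c₂ ^ (-(7 / 4) : ℝ) * p₀ ^ (-(3 / 4) : ℝ)))) + 3 * ε) / Mc a + 2 * β' := by
  classical
  -- abbreviations: the clearance `c`, the rule constants
  obtain ⟨c, hc⟩ : ∃ f : ℝ → ℝ, ∀ s, f s = Y.inf' hY fun y ↦ max m₀ |φ y s| := ⟨_, fun s ↦ rfl⟩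
  have hcy : ∀ s, ∃ y ∈ Y, c s = max m₀ |φ y s| := fun s ↦ by
    obtain ⟨y, hy, h⟩ := Finset.exists_mem_eq_inf' hY (fun y ↦ max m₀ |φ y s|)
    exact ⟨y, hy, (hc s).trans h⟩
  have hcle : ∀ s, ∀ y ∈ Y, c s ≤ max m₀ |φ y s| := fun s y hy ↦ by
    rw [hc s]; exact Finset.inf'_le _ hy
  have hcm₀ : ∀ s, m₀ ≤ c s := fun s ↦ by
    rw [hc s]; exact (Finset.le_inf'_iff hY _).mpr fun y _ ↦ le_max_left _ _
  have hcpos : ∀ s, 0 < c s := fun s ↦ hm₀.trans_le (hcm₀ s)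
  have hφc : ∀ y ∈ Y, Continuous (φ y) := fun y hy ↦
    continuous_iff_continuousAt.mpr fun s ↦ (hφ y hy s).continuousAt
  have hccont : Continuous c := by
    have : c = fun s ↦ Y.inf' hY fun y ↦ max m₀ |φ y s| := funext hc
    rw [this]
    exact Continuous.finset_inf'_apply hY fun y hy ↦ continuous_const.max (hφc y hy).abs
  have hCpos : ∀ j : ℕ, (0 : ℝ) < 4 * 16 ^ j := fun j ↦ by positivity
  -- (b) a strictly free rule at the midpoint
  set sm : ℝ := (p₀ + q₀) / 2 with hsmdef
  have hsmI : sm ∈ Set.Icc p₀ q₀ := ⟨by simp only [hsmdef]; linarith, by simp only [hsmdef]; linarith⟩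
  obtain ⟨j, hjfree⟩ := exists_strictly_free_rule T hn (hcpos sm) (fun p ↦ d p sm)
  set Cj : ℝ := 4 * 16 ^ (j : ℕ) with hCjdef
  have hCj : 0 < Cj := hCpos j
  -- the member set
  set Ms : Finset ι := T.filter (fun p ↦ d p sm < c sm / Cj / 2) with hMsdef
  have hMsT : Ms ⊆ T := Finset.filter_subset _ _
  -- (d) members stay within `R_j/2`, the other partners beyond `2R_j`, on the whole piece
  have hmem : ∀ p ∈ Ms, ∀ s ∈ Set.Icc p₀ q₀, 4 * d p s ≤ 2 * (c s / Cj) := by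
    intro p hp s hs
    obtain ⟨hpT, hpd⟩ := Finset.mem_filter.mp hp
    -- for every `y`: `c_y - 2Cj d > 0` at `sm`, hence `≥ 0` on the piece
    have hall : ∀ y ∈ Y, 0 ≤ max m₀ |φ y s| - 2 * Cj * d p s := by
      intro y hy
      rcases hsign₁ p hpT j y hy with h | h
      · exact h s hs
      · exfalso
        have h0 := h sm hsmI
        have hcy' := hcle sm y hy
        -- `d p sm < c sm/(2Cj) ≤ c_y/(2Cj)` contradicts `c_y - 2Cj d ≤ 0`
        have : 2 * Cj * d p sm < c sm := by
          have := hpd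
          rw [lt_div_iff₀ (by norm_num : (0:ℝ) < 2), lt_div_iff₀ hCj] at this
          linarith
        simp only [hCjdef] at this h0
        linarith
    -- hence `2Cj d ≤ c s`
    obtain ⟨y, hy, hcy'⟩ := hcy s
    have := hall y hy
    rw [← hcy'] at this
    rw [show 2 * (c s / Cj) = (2 * c s) / Cj by ring, le_div_iff₀ hCj]
    nlinarith
  have hnon : ∀ p ∈ T, p ∉ Ms → ∀ s ∈ Set.Icc p₀ q₀, 2 * (c s / Cj) ≤ d p s := by
    intro p hpT hpMs s hs
    have hpd : ¬ d p sm < c sm / Cj / 2 := fun h ↦ hpMs (Finset.mem_filter.mpr ⟨hpT, h⟩)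
    -- strictly free at `sm`: so `2 R_j < d` there
    have hfar : 2 * (c sm / Cj) < d p sm := by
      rcases hjfree p hpT with h | h
      · exact (hpd h).elim
      · exact h
    -- pick `y*` attaining `c` at `sm`: `2 c_{y*} - Cj d < 0` at `sm`, hence `≤ 0` on the piece
    obtain ⟨y, hy, hcy'⟩ := hcy sm
    have hneg : 2 * max m₀ |φ y sm| - Cj * d p sm < 0 := by
      rw [← hcy']
      rw [div_eq_mul_inv] at hfar
      have : 2 * c sm < Cj * d p sm := by
        have h' := hfar
        rw [show 2 * (c sm * Cj⁻¹) = 2 * c sm / Cj by ring, div_lt_iff₀ hCj] at h'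
        linarith
      linarith
    have hle : ∀ s' ∈ Set.Icc p₀ q₀, 2 * max m₀ |φ y s'| - Cj * d p s' ≤ 0 := by
      rcases hsign₂ p hpT j y hy with h | h
      · exfalso
        have := h sm hsmI
        simp only [hCjdef] at this hneg
        linarith
      · intro s' hs'; have := h s' hs'; simp only [hCjdef] at this ⊢; exact this
    have h1 := hle s hs
    have h2 := hcle s y hy
    rw [div_eq_mul_inv]
    have : 2 * c s ≤ Cj * d p s := by linarith
    calc 2 * (c s * Cj⁻¹) = 2 * c s / Cj := by ring
      _ ≤ d p s := by rw [div_le_iff₀ hCj]; linarith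
  -- (e) the package on the whole piece
  have hgeom : ∀ s ∈ Set.Icc p₀ q₀,
      (∀ p ∈ Ms, 4 * d p s ≤ 2 * ((Y.inf' hY fun y ↦ max m₀ |φ y s|) / (4 * 16 ^ (j : ℕ))) ∧
        2 * d p s ≤ c₂ * s) ∧
      (∀ p ∈ T, p ∉ Ms → 2 * ((Y.inf' hY fun y ↦ max m₀ |φ y s|) / (4 * 16 ^ (j : ℕ))) ≤ d p s) := by
    intro s hs
    refine ⟨fun p hp ↦ ⟨?_, ?_⟩, fun p hpT hpMs ↦ ?_⟩
    · rw [← hc s]; exact hmem p hp s hs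
    · -- members are tight: `d ≤ c/(2Cj) ≤ c/8 ≤ c₂ s/8`
      have h1 := hmem p hp s hs
      have h2 : c s ≤ c₂ * s := by rw [hc s]; exact hcap s hs
      have hCj4 : 4 ≤ Cj := by
        have : (1 : ℝ) ≤ 16 ^ (j : ℕ) := one_le_pow₀ (by norm_num)
        simp only [hCjdef]; linarith
      have h3 : c s / Cj ≤ c s / 4 := div_le_div_of_nonneg_left (hcpos s).le (by norm_num) hCj4
      linarith only [h1, h2, h3, hcpos s]
    · rw [← hc s]; exact hnon p hpT hpMs s hs
  obtain ⟨hlaw, hid⟩ := hpkg j Ms hMsT p₀ q₀ le_rfl hpq.le le_rfl hgeom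
  -- (f) the budget along the rule, with `K = C_n`
  set Kn : ℝ := 4 * 16 ^ n with hKndef
  have hKn3 : 3 ≤ Kn := by
    have : (1 : ℝ) ≤ 16 ^ n := one_le_pow₀ (by norm_num)
    simp only [hKndef]; linarith
  have hCjKn : Cj ≤ Kn := by
    simp only [hCjdef, hKndef]
    have : (16 : ℝ) ^ (j : ℕ) ≤ 16 ^ n := pow_le_pow_right₀ (by norm_num) (Nat.lt_succ_iff.mp j.2)
    linarith
  have hRcont : ContinuousOn (fun s ↦ min (c s / Cj) (c₂ * s)) (Set.Icc p₀ q₀) :=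
    ((hccont.div_const Cj).min (continuous_const.mul continuous_id)).continuousOn
  have hR1 : ∀ s ∈ Set.Icc p₀ q₀, 1 ≤ min (c s / Cj) (c₂ * s) := by
    intro s hs
    refine le_min ?_ (by nlinarith [hs.1])
    rw [le_div_iff₀ hCj]
    have := hcm₀ s
    simp only [hCjdef]
    have h16 : (16 : ℝ) ^ (j : ℕ) ≤ 16 ^ n := pow_le_pow_right₀ (by norm_num) (Nat.lt_succ_iff.mp j.2)
    nlinarith
  have hRge : ∀ s ∈ Set.Icc p₀ q₀, ∃ y ∈ Y, min (max m₀ |φ y s| / Kn) (c₂ * s) ≤ min (c s / Cj) (c₂ * s) := by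
    intro s _
    obtain ⟨y, hy, hcy'⟩ := hcy s
    refine ⟨y, hy, min_le_min ?_ le_rfl⟩
    rw [← hcy']
    exact div_le_div_of_nonneg_left (hcpos s).le hCj hCjKn
  have hB := rule_window_budget_le Y (R := fun s ↦ min (c s / Cj) (c₂ * s)) hp₀ hpq.le hm₀ hc₂ hKn3 hg
    hRcont hR1 hRge hφ hφ' hmono
  -- rewrite the law's radius as ours
  have hradius : ∀ s, min ((Y.inf' hY fun y ↦ max m₀ |φ y s|) / (4 * 16 ^ (j : ℕ))) (c₂ * s) =
      min (c s / Cj) (c₂ * s) := fun s ↦ by rw [← hc s]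
  have hlaw' : ∀ μ : Fin 4, |Qw j Ms q₀ μ - Qw j Ms p₀ μ| ≤
      Cw * (∫ s in p₀..q₀, ((min (c s / Cj) (c₂ * s)) ^ 2)⁻¹ + ((min (c s / Cj) (c₂ * s)) ^ (7 / 4 : ℝ))⁻¹) +
        ew p₀ := by
    intro μ
    have := hlaw μ
    simp only [hradius] at this
    exact this
  -- (g) the increment of the anchor
  have hMins : ∀ c' ∈ insert a Ms, 0 < Mc c' := fun c' hc' ↦ by
    rcases Finset.mem_insert.mp hc' with h | h
    · exact hM c' (Finset.mem_insert.mpr (Or.inl h))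
    · exact hM c' (Finset.mem_insert_of_mem (hMsT h))
  have hvk' : ∀ c' ∈ insert a Ms, ‖v c' p₀‖ ≤ k ∧ ‖v c' q₀‖ ≤ k := fun c' hc' ↦ by
    rcases Finset.mem_insert.mp hc' with h | h
    · exact hvk c' (Finset.mem_insert.mpr (Or.inl h))
    · exact hvk c' (Finset.mem_insert_of_mem (hMsT h))
  have hr' : ∀ c' ∈ insert a Ms, ‖v c' p₀ - v a p₀‖ ≤ β' ∧ ‖v c' q₀ - v a q₀‖ ≤ β' := fun c' hc' ↦ by
    rcases Finset.mem_insert.mp hc' with h | h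
    · subst h; simp only [sub_self, norm_zero]; exact ⟨hβ', hβ'⟩
    · exact hr c' (hMsT h)
  have hinc := cluster_increment_of_budget (insert a Ms) (Finset.mem_insert_self a Ms) hk1 hCw hMins hvk' hr'
    hlaw' hB hid hew
  refine hinc.trans ?_
  -- smaller denominator `Mc a ≤ Σ`
  have hMa : Mc a ≤ ∑ c' ∈ insert a Ms, Mc c' :=
    Finset.single_le_sum (fun c' hc' ↦ (hMins c' hc').le) (Finset.mem_insert_self a Ms)
  have hMapos : 0 < Mc a := hM a (Finset.mem_insert_self a T)
  have hnum : 0 ≤ 4 * (Cw * (∑ y ∈ Y, (9 * (2 * 2 * (3 * m₀ / Kn) ^ (1 - 2 : ℝ) / ((2 - 1) * (3 * g y / Kn))) +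
      (3 : ℝ) ^ (7 / 4 : ℝ) * (2 * (7 / 4) * (3 * m₀ / Kn) ^ (1 - 7 / 4 : ℝ) / ((7 / 4 - 1) * (3 * g y / Kn))) +
      ((c₂ ^ 2 * p₀)⁻¹ + 4 / 3 * c₂ ^ (-(7 / 4) : ℝ) * p₀ ^ (-(3 / 4) : ℝ)))) + 3 * ε) := by
    have hε : 0 ≤ ε := by
      have h1 := (hid p₀ (Or.inl rfl)).1
      exact ((abs_nonneg _).trans h1).trans hew.1
    have hsum : 0 ≤ ∑ y ∈ Y, (9 * (2 * 2 * (3 * m₀ / Kn) ^ (1 - 2 : ℝ) / ((2 - 1) * (3 * g y / Kn))) +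
        (3 : ℝ) ^ (7 / 4 : ℝ) * (2 * (7 / 4) * (3 * m₀ / Kn) ^ (1 - 7 / 4 : ℝ) / ((7 / 4 - 1) * (3 * g y / Kn))) +
        ((c₂ ^ 2 * p₀)⁻¹ + 4 / 3 * c₂ ^ (-(7 / 4) : ℝ) * p₀ ^ (-(3 / 4) : ℝ))) :=
      Finset.sum_nonneg fun y hy ↦ by have := hg y hy; positivity
    positivity
  have := div_le_div_of_nonneg_left hnum hMapos hMa
  simp only [hKndef] at this ⊢
  linarith

end StatusPiece

end Summit.FinalStateConjecture.FinalStateConjecture.Theorems.ChargeKinematics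

namespace Summit.FinalStateConjecture.FinalStateConjecture.Theorems

/-- REGISTERED STUB `increment_on_status_piece` of the crux item stmt-FinalStateConjecture-10166 (second line lead, line
`old-light-leaves-the-cone`, S4): the registered signature verbatim, by `ChargeKinematics.increment_on_status_piece`. [folklore] -/
theorem increment_on_status_piece : open Literature.Geometry.Lorentzian Filter Topology MeasureTheory intervalIntegral in ∀ {ι κι : Type*} [DecidableEq ι] (T : Finset ι) (a : ι) (Y : Finset κι) (hY : Y.Nonempty) {n : ℕ} (hn : T.card ≤ n) {d : ι → ℝ → ℝ} {φ φ' : κι → ℝ → ℝ} {g : κι → ℝ} {Mc : ι → ℝ} {v : ι → ℝ → E3} {Qw : Fin (n + 1) → Finset ι → ℝ → Fin 4 → ℝ} {ew : ℝ → ℝ} {Cw k p₀ q₀ m₀ c₂ ε β' : ℝ} (hk1 : k < 1) (hp₀ : 0 < p₀) (hpq : p₀ < q₀) (hm₀ : 0 < m₀) (hm₀C : 4 * 16 ^ n ≤ m₀) (hc₂ : 0 < c₂) (hct : 1 ≤ c₂ * p₀) (hCw : 0 ≤ Cw) (hM : ∀ c ∈ insert a T, 0 < Mc c) (haT : a ∉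 T) (hvk : ∀ c ∈ insert a T, ‖v c p₀‖ ≤ k ∧ ‖v c q₀‖ ≤ k) (hr : ∀ p ∈ T, ‖v p p₀ - v a p₀‖ ≤ β' ∧ ‖v p q₀ - v a q₀‖ ≤ β') (hβ' : 0 ≤ β') (hcap : ∀ s ∈ Set.Icc p₀ q₀, (Y.inf' hY fun y ↦ max m₀ |φ y s|) ≤ c₂ * s) (hg : ∀ y ∈ Y, 0 < g y) (hφ : ∀ y ∈ Y, ∀ s, HasDerivAt (φ y) (φ' y s) s) (hφ' : ∀ y ∈ Y, Continuous (φ' y)) (hmono : ∀ y ∈ Y, ∀ s ∈ Set.Icc p₀ q₀, g y ≤ φ' y s) (hsign₁ : ∀ p ∈ T, ∀ j : Fin (n + 1), ∀ y ∈ Y, (∀ s ∈ Set.Icc p₀ q₀, 0 ≤ max m₀ |φ y s| - 2 * (4 * 16 ^ (j : ℕ)) * d p s) ∨ (∀ s ∈ Set.Icc p₀ q₀, max m₀ |φ y s| - 2 * (4 * 16 ^ (j : ℕ)) * d p s ≤ 0)) (hsign₂ : ∀ p ∈ T, ∀ j : Fin (n + 1), ∀ y ∈ Y, (∀ s ∈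 Set.Icc p₀ q₀, 0 ≤ 2 * max m₀ |φ y s| - (4 * 16 ^ (j : ℕ)) * d p s) ∨ (∀ s ∈ Set.Icc p₀ q₀, 2 * max m₀ |φ y s| - (4 * 16 ^ (j : ℕ)) * d p s ≤ 0)) (hpkg : ∀ (j : Fin (n + 1)) (Ms : Finset ι), Ms ⊆ T → ∀ s₁ s₂, p₀ ≤ s₁ → s₁ ≤ s₂ → s₂ ≤ q₀ → (∀ s ∈ Set.Icc s₁ s₂, (∀ p ∈ Ms, 4 * d p s ≤ 2 * ((Y.inf' hY fun y ↦ max m₀ |φ y s|) / (4 * 16 ^ (j : ℕ))) ∧ 2 * d p s ≤ c₂ * s) ∧ (∀ p ∈ T, p ∉ Ms → 2 * ((Y.inf' hY fun y ↦ max m₀ |φ y s|) / (4 * 16 ^ (j : ℕ))) ≤ d p s)) → (∀ μ : Fin 4, |Qw j Ms s₂ μ - Qw j Ms s₁ μ| ≤ Cw * (∫ s in s₁..s₂, ((min ((Y.inf' hY fun y ↦ max m₀ |φ y s|) / (4 * 16 ^ (j : ℕ))) (c₂ * s)) ^ 2)⁻¹ + ((min ((Y.inf' hY fun y ↦ max m₀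 |φ y s|) / (4 * 16 ^ (j : ℕ))) (c₂ * s)) ^ (7 / 4 : ℝ))⁻¹) + ew s₁) ∧ (∀ s, (s = s₁ ∨ s = s₂) → |Qw j Ms s 0 - ∑ c ∈ insert a Ms, Mc c * (√(1 - ‖v c s‖ ^ 2))⁻¹| ≤ ew s ∧ ∀ k' : Fin 3, |Qw j Ms s k'.succ - ∑ c ∈ insert a Ms, Mc c * (√(1 - ‖v c s‖ ^ 2))⁻¹ * v c s k'| ≤ ew s)) (hew : ew p₀ ≤ ε ∧ ew q₀ ≤ ε), ‖v a q₀ - v a p₀‖ ≤ 4 * (Cw * (∑ y ∈ Y, (9 * (2 * 2 * (3 * m₀ / (4 * 16 ^ n)) ^ (1 - 2 : ℝ) / ((2 - 1) * (3 * g y / (4 * 16 ^ n)))) + (3 : ℝ) ^ (7 / 4 : ℝ) * (2 * (7 / 4) * (3 * m₀ / (4 * 16 ^ n)) ^ (1 - 7 / 4 : ℝ) / ((7 / 4 - 1) * (3 * g y / (4 * 16 ^ n)))) + ((c₂ ^ 2 * p₀)⁻¹ + 4 / 3 * c₂ ^ (-(7 / 4) : ℝ) * p₀ ^ (-(3 /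 4) : ℝ)))) + 3 * ε) / Mc a + 2 * β' :=
  @ChargeKinematics.increment_on_status_piece

end Summit.FinalStateConjecture.FinalStateConjecture.Theorems

end
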